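import Literature.AlgebraicTopology.Homotopy.FibreBundlesCellHomology
import Literature.AlgebraicTopology.Homotopy.FibreBundlesWeakEquivalence
import Literature.AlgebraicTopology.SingularHomology.WeakEquivalenceHomology
import Literature.AlgebraicTopology.SingularHomology.PairTimesInterval
import Literature.AlgebraicTopology.SingularHomology.DeformationRetractHomology
import HarnessLib

/-!
# Fibre bundles over an attached cell: `χ(p⁻¹(Y ∪ ē), p⁻¹Y) = (-1)ⁿ χ(F)`

Topic `Literature/AlgebraicTopology/Homotopy`. The `E¹`-term computation of the spectral sequence of
a fibration, one cell at a time and in Euler-characteristic form (E. H. Spanier, *Algebraic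
Topology* (1981), Ch. 9, Sec. 2, Lemma 2 and Thm. 15 (a): "`ψ_* : H_s(e, ė; Hₙ(F)) ≈
H_{n+s}(p⁻¹(e), p⁻¹(ė))`"; for the base alone A. Hatcher, *Algebraic Topology* (2002),
Lemma 2.34 (a)), a brick of the printed proof of
`Literature.AlgebraicTopology.Homotopy.Spanier1981_eulerChar_fibreBundle` (Ch. 9, Sec. 3, Thm. 1).
For a fibre bundle `p : E → X` with fibre `F` over a Hausdorff space `X = Y ∪ Φ(𝔹ⁿ)` obtained from
a closed `Y` by attaching one `n`-cell (`Φ` continuous on the closed sup-norm ball, injective on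
the open ball, the sphere into `Y`, the open cell off `Y` — the cells of Mathlib's classical CW
complexes), and a field `R`: if `H_•(F; R)` is finite-dimensional and bounded then so is
`H_•(E, p⁻¹Y; R)`, and `χ(E, p⁻¹Y) = (-1)ⁿ χ(F)` (`IsFibreBundleWith.finRelHomology_preimage_of_cell`).
All PROVED:

* `isWeakHomotopyEquiv_subsetInclusion_of_isStrongDeformationRetractOf` — the inclusion of a
  strong deformation retract is a weak homotopy equivalence;
* `IsFibreBundleWith.isWeakHomotopyEquiv_preimage_inclusion`,
  `IsFibreBundleWith.isZero_relativeSingularHomology_preimage` — over a weak homotopy equivalence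
  of subspaces `S ↪ T` of the base, `p⁻¹S ↪ p⁻¹T` is a weak homotopy equivalence
  (`isWeakHomotopyEquiv_pullback_snd`, Spanier 9.2.17) and `H_•(p⁻¹T, p⁻¹S; R) = 0`
  (`isZero_relativeSingularHomology_of_isWeakHomotopyEquiv`, Spanier 7.6.25);
* `IsFibreBundleWith.finRelHomology_preimage_of_cell` — the theorem: thicken `Y` by the collar
  `Φ(¼ ≤ ‖x‖ ≤ 1)` (a strong deformation retract, `isStrongDeformationRetractOf_union_image_collar`,
  so the preimages have vanishing relative homology), excise down to `p⁻¹Φ(‖x‖ ≤ ½)`, where `Φ`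
  is an embedding and the bundle is trivial (`exists_homeomorph_prod_of_homeomorph_cube`), and
  finish in the model `(𝔹ⁿ × F, (½ ≤ ‖x‖) × F) ∼ (𝔹ⁿ × F, ∂𝔹ⁿ × F) ≅ (Iⁿ × F, ∂Iⁿ × F)`
  (`isStrongDeformationRetractOf_collar_prod`, `FinRelHomology.cube_prod`), bookkeeping the Euler
  characteristics along the exact sequences of the triples (`FinRelHomology.triple_right/mid`).

## References

* E. H. Spanier, *Algebraic Topology*, Springer (1981), Ch. 9, Sec. 2, Lemma 2, Thm. 15 (a),
  Thm. 17; Ch. 7, Sec. 6, Thm. 25. [Spanier1981]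
* A. Hatcher, *Algebraic Topology*, CUP (2002), §2.2 Lemma 2.34 (a), §2.1 Thm. 2.20, p. 118.
  [HatcherAT2002]
-/

noncomputable section

open scoped unitInterval
open Function Set Metric CategoryTheory CategoryTheory.Limits
open _root_.Topology
open Literature.AlgebraicTopology.SingularHomology

namespace Literature.AlgebraicTopology.Homotopy

universe u v w uR

/-! ### Strong deformation retracts and weak equivalences -/

/-- The inclusion of a strong deformation retract `A ⊆ S` is a weak homotopy equivalence (it is a
homotopy equivalence with inverse the retraction; Miller 2020, Prop. 46.6). [folklore] -/
theorem isWeakHomotopyEquiv_subsetInclusion_of_isStrongDeformationRetractOf {X : Type v}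
    [TopologicalSpace X] {A S : Set X} (h : IsStrongDeformationRetractOf A S) (hAS : A ⊆ S) :
    IsWeakHomotopyEquiv (subsetInclusion hAS) := by
  let e : ContinuousMap.HomotopyEquiv ↥A ↥S :=
    { toFun := subsetInclusion hAS
      invFun := h.retraction
      left_inv := by rw [h.retraction_comp_inclusion hAS]
      right_inv := ⟨(h.homotopyInclusionCompRetraction hAS).symm⟩ }
  exact isWeakHomotopyEquiv_homotopyEquiv e

/-! ### Preimages of weakly equivalent subspaces of the base -/

namespace IsFibreBundleWith

variable {E : Type u} {X : Type v} {F : Type w} [TopologicalSpace E] [TopologicalSpace X]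
  [TopologicalSpace F] {p : E → X}

/-- **Over a weak homotopy equivalence of subspaces `S ↪ T` of the base, `p⁻¹S ↪ p⁻¹T` is a weak
homotopy equivalence** (Spanier 1981, Ch. 9, Sec. 2, proof of Thm. 17, through
`isWeakHomotopyEquiv_pullback_snd`: `p⁻¹S` is the pullback of `p⁻¹T → T` along `S ↪ T`).
[cite: Spanier1981, Ch. 9, Sec. 2, Thm. 17 (proof)] -/
theorem isWeakHomotopyEquiv_preimage_inclusion (hp : IsFibreBundleWith F p) {S T : Set X}
    (hST : S ⊆ T) (hw : IsWeakHomotopyEquiv (subsetInclusion hST)) :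
    IsWeakHomotopyEquiv (subsetInclusion (preimage_mono hST : p ⁻¹' S ⊆ p ⁻¹' T)) := by
  have hT := hp.restrictPreimage T
  have h4 := hT.isWeakHomotopyEquiv_pullback_snd (subsetInclusion hST) hw
  -- `p⁻¹S` is the pullback
  have hmem : ∀ z : (⇑(subsetInclusion hST)).Pullback (T.restrictPreimage p),
      (z.snd : E) ∈ p ⁻¹' S := fun z => by
    have h := congrArg Subtype.val z.2
    show p (z.snd : E) ∈ S
    have h' : (z.fst : X) = p (z.snd : E) := h
    rw [← h']
    exact z.fst.2
  let ψ : ↥(p ⁻¹' S) ≃ₜ (⇑(subsetInclusion hST)).Pullback (T.restrictPreimage p) :=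
    { toFun := fun e => ⟨(⟨p e, e.2⟩, ⟨(e : E), hST e.2⟩), rfl⟩
      invFun := fun z => ⟨(z.snd : E), hmem z⟩
      left_inv := fun e => rfl
      right_inv := fun z => by
        apply Subtype.ext
        refine Prod.ext (Subtype.ext ?_) rfl
        have h : (z.fst : X) = p (z.snd : E) := congrArg Subtype.val z.2
        exact h.symm
      continuous_toFun := by
        refine Continuous.subtype_mk (Continuous.prodMk ?_ ?_) _
        · exact (hp.continuous.comp continuous_subtype_val).subtype_mk _
        · exact continuous_subtype_val.subtype_mk _
      continuous_invFun := (continuous_subtype_val.comp (continuous_snd.comp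
        continuous_subtype_val)).subtype_mk _ }
  have hfac : subsetInclusion (preimage_mono hST : p ⁻¹' S ⊆ p ⁻¹' T) =
      (⟨Function.Pullback.snd, continuous_snd.comp continuous_subtype_val⟩ :
        C((⇑(subsetInclusion hST)).Pullback (T.restrictPreimage p), ↥(p ⁻¹' T))).comp
        (ψ : C(↥(p ⁻¹' S), _)) := by
    ext e; rfl
  rw [hfac]
  exact h4.comp (IsWeakHomotopyEquiv.of_homeomorph ψ)

/-- **`H_•(p⁻¹T, p⁻¹S; R) = 0` over a weak homotopy equivalence of subspaces `S ↪ T`** (the pair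
realised on `↥(p⁻¹T)`; Spanier 7.6.25 for the weak equivalence `p⁻¹S ↪ p⁻¹T`).
[cite: Spanier1981, Ch. 7, Sec. 6, Thm. 25] -/
theorem isZero_relativeSingularHomology_preimage (hp : IsFibreBundleWith F p) {S T : Set X}
    (hST : S ⊆ T) (hw : IsWeakHomotopyEquiv (subsetInclusion hST)) (R : Type uR) [CommRing R]
    (i : ℕ) :
    IsZero (relativeSingularHomology R R ↥(p ⁻¹' T) (Subtype.val ⁻¹' (p ⁻¹' S)) i) := by
  apply isZero_relativeSingularHomology_of_isWeakHomotopyEquiv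
  let e := preimageValHomeomorphOfSubset (preimage_mono hST : p ⁻¹' S ⊆ p ⁻¹' T)
  have hfac : subsetIncl (Subtype.val ⁻¹' (p ⁻¹' S) : Set ↥(p ⁻¹' T)) =
      (subsetInclusion (preimage_mono hST : p ⁻¹' S ⊆ p ⁻¹' T)).comp
        (e : C(↥(Subtype.val ⁻¹' (p ⁻¹' S) : Set ↥(p ⁻¹' T)), ↥(p ⁻¹' S))) := by
    ext z; rfl
  rw [hfac]
  exact (hp.isWeakHomotopyEquiv_preimage_inclusion hST hw).comp (IsWeakHomotopyEquiv.of_homeomorph e)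

/-! ### The cell theorem -/

/-- The closed ball of radius `2⁻¹` scaled onto the closed unit ball (sup norm). [folklore] -/
def closedBallHalfHomeomorph (n : ℕ) :
    ↥(closedBall (0 : Fin n → ℝ) 2⁻¹) ≃ₜ ↥(closedBall (0 : Fin n → ℝ) 1) where
  toFun v := ⟨(2 : ℝ) • (v : Fin n → ℝ), by
    have hv := mem_closedBall_zero_iff.1 v.2
    rw [mem_closedBall_zero_iff, norm_smul, Real.norm_eq_abs, abs_of_pos two_pos]
    linarith⟩
  invFun u := ⟨(2⁻¹ : ℝ) • (u : Fin n → ℝ), by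
    have hu := mem_closedBall_zero_iff.1 u.2
    rw [mem_closedBall_zero_iff, norm_smul, Real.norm_eq_abs, abs_of_pos (by norm_num)]
    linarith⟩
  left_inv v := Subtype.ext (by simp [smul_smul])
  right_inv u := Subtype.ext (by simp [smul_smul])
  continuous_toFun := (continuous_subtype_val.const_smul (2 : ℝ)).subtype_mk _
  continuous_invFun := (continuous_subtype_val.const_smul (2⁻¹ : ℝ)).subtype_mk _

/-- Pointwise formula for `closedBallHalfHomeomorph`. [folklore] -/
@[simp]
theorem closedBallHalfHomeomorph_apply_coe {n : ℕ} (v : ↥(closedBall (0 : Fin n → ℝ) 2⁻¹)) :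
    ((closedBallHalfHomeomorph n v : ↥(closedBall (0 : Fin n → ℝ) 1)) : Fin n → ℝ) =
      (2 : ℝ) • (v : Fin n → ℝ) := rfl

/-- Norm under the scaling `closedBallHalfHomeomorph`. [folklore] -/
theorem norm_closedBallHalfHomeomorph {n : ℕ} (v : ↥(closedBall (0 : Fin n → ℝ) 2⁻¹)) :
    ‖((closedBallHalfHomeomorph n v : ↥(closedBall (0 : Fin n → ℝ) 1)) : Fin n → ℝ)‖ =
      2 * ‖(v : Fin n → ℝ)‖ := by
  rw [closedBallHalfHomeomorph_apply_coe, norm_smul, Real.norm_eq_abs, abs_of_pos two_pos]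

/-- **`χ(p⁻¹(Y ∪ ē), p⁻¹Y) = (-1)ⁿ χ(F)` for a fibre bundle over a space with one `n`-cell attached**
(Spanier 1981, Ch. 9, Sec. 2, Lemma 2 with Thm. 15 (a), in Euler-characteristic form; Hatcher
2002, Lemma 2.34 (a) for the base): `X` Hausdorff, `Y ⊆ X` closed, `Φ : ℝⁿ → X` continuous on the
closed unit ball (sup norm), injective on the open ball, `Φ(‖x‖ = 1) ⊆ Y`, `Φ(‖x‖ < 1) ∩ Y = ∅`,
`X = Y ∪ Φ(𝔹ⁿ)`; `p : E → X` a fibre bundle with fibre `F`; `R` a field with `H_•(F; R)`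
finite-dimensional and zero from degree `N` on. Then `H_•(E, p⁻¹Y; R)` is finite-dimensional,
zero from degree `N + n + 1` on, and `χ(E, p⁻¹Y) = (-1)ⁿ χ(F)`.
[cite: Spanier1981, Ch. 9, Sec. 2, Lemma 2 and Thm. 15 (a)] -/
theorem finRelHomology_preimage_of_cell {E : Type u} {X : Type v} {F : Type w} [TopologicalSpace E]
    [TopologicalSpace X] [T2Space X] [TopologicalSpace F] {p : E → X} (hp : IsFibreBundleWith F p)
    {n : ℕ} {Y : Set X} (hY : IsClosed Y) (Φ : (Fin n → ℝ) → X)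
    (hΦ : ContinuousOn Φ (closedBall 0 1)) (hinj : InjOn Φ (ball 0 1))
    (hsph : ∀ x : Fin n → ℝ, ‖x‖ = 1 → Φ x ∈ Y) (hdisj : ∀ x : Fin n → ℝ, ‖x‖ < 1 → Φ x ∉ Y)
    (hcov : Y ∪ Φ '' closedBall 0 1 = univ) (R : Type uR) [Field R] {N : ℕ}
    (hF : FinRelHomology R R F ∅ N) :
    FinRelHomology R R E (p ⁻¹' Y) (N + n + 1) ∧
      relEuler R R E (p ⁻¹' Y) = (-1) ^ n * relEuler R R F ∅ := by
  classical
  /- set-theoretic preliminaries about the cell -/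
  have hF1 : ∀ x : X, x ∉ Y → ∃ c : Fin n → ℝ, ‖c‖ < 1 ∧ Φ c = x := fun x hx => by
    have hx' : x ∈ Y ∪ Φ '' closedBall 0 1 := by rw [hcov]; exact mem_univ x
    rcases hx' with h | ⟨c, hc, hcx⟩
    · exact absurd h hx
    · refine ⟨c, lt_of_le_of_ne (mem_closedBall_zero_iff.1 hc) fun h1 => hx ?_, hcx⟩
      rw [← hcx]; exact hsph c h1
  have hF2 : ∀ c c' : Fin n → ℝ, ‖c‖ < 1 → ‖c'‖ ≤ 1 → Φ c' = Φ c → c' = c := fun c c' hc hc' h => by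
    rcases lt_or_eq_of_le hc' with h' | h'
    · exact hinj (mem_ball_zero_iff.2 h') (mem_ball_zero_iff.2 hc) h
    · exact absurd (h ▸ hsph c' h') (hdisj c hc)
  -- the thickening of `Y`
  set C : Set (Fin n → ℝ) := {x | 4⁻¹ ≤ ‖x‖ ∧ ‖x‖ ≤ 1} with hC
  set A' : Set X := Y ∪ Φ '' C with hA'
  have hYA' : Y ⊆ A' := subset_union_left
  /- Step 1: `H_•(p⁻¹A', p⁻¹Y) = 0` -/
  have hsdr : IsStrongDeformationRetractOf Y A' :=
    isStrongDeformationRetractOf_union_image_collar hY Φ hΦ hinj hsph hdisj (by norm_num) (by norm_num)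
  have hzero : ∀ k, IsZero (relativeSingularHomology R R ↥(p ⁻¹' A') (Subtype.val ⁻¹' (p ⁻¹' Y)) k) :=
    hp.isZero_relativeSingularHomology_preimage hYA'
      (isWeakHomotopyEquiv_subsetInclusion_of_isStrongDeformationRetractOf hsdr hYA') R
  /- Step 2: excision down to `p⁻¹Φ(‖x‖ ≤ ½)` -/
  set W : Set X := Φ '' closedBall 0 2⁻¹ with hW
  set K : Set E := p ⁻¹' W with hK
  have hball_sub : closedBall (0 : Fin n → ℝ) 2⁻¹ ⊆ ball 0 1 :=
    closedBall_subset_ball (by norm_num)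
  have hball_sub' : closedBall (0 : Fin n → ℝ) 2⁻¹ ⊆ closedBall 0 1 :=
    closedBall_subset_closedBall (by norm_num)
  -- `Φ(‖x‖ < ½)` is open: its complement is `Y ∪ Φ(½ ≤ ‖x‖ ≤ 1)`
  have hopen : IsOpen (Φ '' ball (0 : Fin n → ℝ) 2⁻¹) := by
    have hcpt : IsCompact (Φ '' {x : Fin n → ℝ | 2⁻¹ ≤ ‖x‖ ∧ ‖x‖ ≤ 1}) := by
      refine IsCompact.image_of_continuousOn ?_ (hΦ.mono fun x hx => mem_closedBall_zero_iff.2 hx.2)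
      refine (isCompact_closedBall (0 : Fin n → ℝ) 1).of_isClosed_subset ?_
        fun x hx => mem_closedBall_zero_iff.2 hx.2
      have : {x : Fin n → ℝ | 2⁻¹ ≤ ‖x‖ ∧ ‖x‖ ≤ 1} = (fun x => ‖x‖) ⁻¹' Icc (2⁻¹ : ℝ) 1 := by
        ext x; simp [mem_Icc]
      rw [this]; exact isClosed_Icc.preimage continuous_norm
    have heq : Φ '' ball (0 : Fin n → ℝ) 2⁻¹ = (Y ∪ Φ '' {x : Fin n → ℝ | 2⁻¹ ≤ ‖x‖ ∧ ‖x‖ ≤ 1})ᶜ := by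
      ext x
      constructor
      · rintro ⟨c, hc, rfl⟩ hx
        have hc1 : ‖c‖ < 1 := lt_of_lt_of_le (mem_ball_zero_iff.1 hc) (by norm_num)
        rcases hx with hx | ⟨c', hc', hcc'⟩
        · exact hdisj c hc1 hx
        · have := hF2 c c' hc1 hc'.2 hcc'
          subst this
          exact absurd (mem_ball_zero_iff.1 hc) (not_lt.2 hc'.1)
      · intro hx
        rw [mem_compl_iff, mem_union, not_or] at hx
        obtain ⟨c, hc1, rfl⟩ := hF1 x hx.1
        refine ⟨c, mem_ball_zero_iff.2 ?_, rfl⟩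
        by_contra h
        exact hx.2 ⟨c, ⟨not_lt.1 h, hc1.le⟩, rfl⟩
    rw [heq]
    exact (hY.union hcpt.isClosed).isOpen_compl
  -- the open set `X ∖ Φ(‖x‖ ≤ ¼)` lies in `A'`
  have hO_open : IsOpen (Φ '' closedBall (0 : Fin n → ℝ) 4⁻¹)ᶜ := by
    refine (IsCompact.image_of_continuousOn (isCompact_closedBall _ _)
      (hΦ.mono (closedBall_subset_closedBall (by norm_num)))).isClosed.isOpen_compl
  have hO_sub : (Φ '' closedBall (0 : Fin n → ℝ) 4⁻¹)ᶜ ⊆ A' := fun x hx => by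
    by_cases hxY : x ∈ Y
    · exact Or.inl hxY
    · obtain ⟨c, hc1, rfl⟩ := hF1 x hxY
      refine Or.inr ⟨c, ⟨?_, hc1.le⟩, rfl⟩
      by_contra h
      exact hx ⟨c, mem_closedBall_zero_iff.2 (not_le.1 h).le, rfl⟩
  -- excision hypothesis for `U = Kᶜ`
  have hexc_hyp : closure Kᶜ ⊆ interior (p ⁻¹' A') := by
    have h1 : Kᶜ ⊆ (p ⁻¹' (Φ '' ball (0 : Fin n → ℝ) 2⁻¹))ᶜ :=
      compl_subset_compl.2 (preimage_mono (image_mono ball_subset_closedBall))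
    have h2 : IsClosed (p ⁻¹' (Φ '' ball (0 : Fin n → ℝ) 2⁻¹))ᶜ :=
      (hopen.preimage hp.continuous).isClosed_compl
    refine (closure_minimal h1 h2).trans ?_
    refine (interior_maximal ?_ (hO_open.preimage hp.continuous)).trans' ?_
    · exact preimage_mono hO_sub
    · exact compl_subset_compl.2 (preimage_mono (image_mono
        (closedBall_subset_ball (by norm_num) : closedBall (0 : Fin n → ℝ) 4⁻¹ ⊆ ball 0 2⁻¹)))
  have hexc := fun k => relativeSingularHomology.isIso_map_of_closure_subset_interior_holds R R E
    (A := p ⁻¹' A') (U := Kᶜ) hexc_hyp k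
  /- Step 3: the piece over `Φ(‖x‖ ≤ ½)` is a product -/
  haveI : CompactSpace ↥(closedBall (0 : Fin n → ℝ) 2⁻¹) :=
    isCompact_iff_compactSpace.1 (isCompact_closedBall _ _)
  let Φh : C(↥(closedBall (0 : Fin n → ℝ) 2⁻¹), X) :=
    ⟨fun c => Φ c, hΦ.comp_continuous continuous_subtype_val fun c => hball_sub' c.2⟩
  have hΦh_inj : Injective Φh := fun c c' h =>
    Subtype.ext (hinj (hball_sub c.2) (hball_sub c'.2) h)
  have hemb : IsClosedEmbedding Φh := Φh.continuous.isClosedEmbedding hΦh_inj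
  have hrange : range Φh = W := by
    rw [hW, image_eq_range]
    rfl
  -- `↥W ≃ₜ ↥𝔹_{½} ≃ₜ ↥𝔹 ≃ₜ Iⁿ`
  let θW : ↥W ≃ₜ ↥(closedBall (0 : Fin n → ℝ) 2⁻¹) :=
    ((Homeomorph.setCongr hrange).symm).trans hemb.isEmbedding.toHomeomorph.symm
  have hθW : ∀ c : ↥(closedBall (0 : Fin n → ℝ) 2⁻¹), θW ⟨Φ c, ⟨c, c.2, rfl⟩⟩ = c := fun c => by
    apply hΦh_inj
    have h1 : (⟨Φ c, ⟨c, c.2, rfl⟩⟩ : ↥W) = (Homeomorph.setCongr hrange)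
        (hemb.isEmbedding.toHomeomorph c) := Subtype.ext rfl
    show Φh (θW ⟨Φ c, ⟨c, c.2, rfl⟩⟩) = Φh c
    rw [h1]
    show Φh (hemb.isEmbedding.toHomeomorph.symm ((Homeomorph.setCongr hrange).symm
      ((Homeomorph.setCongr hrange) (hemb.isEmbedding.toHomeomorph c)))) = Φh c
    rw [Homeomorph.symm_apply_apply, Homeomorph.symm_apply_apply]
  let θ : ↥W ≃ₜ (Fin n → I) :=
    θW.trans ((closedBallHalfHomeomorph n).trans (closedBallHomeomorphCube n))
  have hKW : IsFibreBundleWith F (W.restrictPreimage p) := hp.restrictPreimage W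
  obtain ⟨τ, hτ⟩ := hKW.exists_homeomorph_prod_of_homeomorph_cube θ
  -- `Ψ : ↥K ≃ₜ ↥𝔹 × F`
  let Ψ : ↥K ≃ₜ ↥(closedBall (0 : Fin n → ℝ) 1) × F :=
    τ.trans ((θW.trans (closedBallHalfHomeomorph n)).prodCongr (Homeomorph.refl F))
  -- the collar `A'` corresponds to `½ ≤ ‖v‖`
  set CF : Set (↥(closedBall (0 : Fin n → ℝ) 1) × F) :=
    {v : ↥(closedBall (0 : Fin n → ℝ) 1) | 2⁻¹ ≤ ‖(v : Fin n → ℝ)‖} ×ˢ (univ : Set F) with hCF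
  set SF : Set (↥(closedBall (0 : Fin n → ℝ) 1) × F) :=
    {v : ↥(closedBall (0 : Fin n → ℝ) 1) | ‖(v : Fin n → ℝ)‖ = 1} ×ˢ (univ : Set F) with hSF
  have hΨ : ∀ e : ↥K, e ∈ (Subtype.val ⁻¹' (p ⁻¹' A') : Set ↥K) ↔ Ψ e ∈ CF := fun e => by
    -- the preimage `c` of `p e` in the half ball
    obtain ⟨c, hc, hce⟩ : (p (e : E)) ∈ W := e.2
    have hc1 : ‖c‖ < 1 := lt_of_le_of_lt (mem_closedBall_zero_iff.1 hc) (by norm_num)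
    have hfst : (Ψ e).1 = closedBallHalfHomeomorph n (θW (τ e).1) := rfl
    have hτe : (τ e).1 = ⟨Φ c, ⟨c, hc, rfl⟩⟩ := by
      rw [hτ]; exact Subtype.ext hce.symm
    have hnorm : ‖((Ψ e).1 : Fin n → ℝ)‖ = 2 * ‖c‖ := by
      rw [hfst, hτe, hθW ⟨c, hc⟩, norm_closedBallHalfHomeomorph]
    show p (e : E) ∈ A' ↔ Ψ e ∈ CF
    rw [← hce]
    simp only [hCF, mem_prod, mem_univ, and_true, mem_setOf_eq, hnorm]
    constructor
    · rintro (h | ⟨c', hc', hcc'⟩)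
      · exact absurd h (hdisj c hc1)
      · have := hF2 c c' hc1 hc'.2 hcc'
        subst this
        linarith [hc'.1]
    · intro h
      exact Or.inr ⟨c, ⟨by linarith, hc1.le⟩, rfl⟩
  /- Step 4: the model `(𝔹 × F, (½ ≤ ‖v‖) × F)` -/
  have hSC : SF ⊆ CF := fun z hz => ⟨by have h : ‖(z.1 : Fin n → ℝ)‖ = 1 := hz.1; rw [mem_setOf_eq, h]; norm_num, mem_univ _⟩
  -- `(𝔹 × F, sphere × F)` from the cube model
  obtain ⟨hcube, hχcube⟩ := FinRelHomology.cube_prod R R hF n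
  let eB : (Fin n → I) × F ≃ₜ ↥(closedBall (0 : Fin n → ℝ) 1) × F :=
    (closedBallHomeomorphCube n).symm.prodCongr (Homeomorph.refl F)
  have heB : MapsTo eB (Cube.boundary (Fin n) ×ˢ (univ : Set F)) SF := fun z hz =>
    ⟨mem_sphere_zero_iff_norm.1 ((closedBallHomeomorphCube_symm_mem_sphere_iff z.1).2 hz.1), mem_univ _⟩
  have heB' : MapsTo eB.symm SF (Cube.boundary (Fin n) ×ˢ (univ : Set F)) := fun z hz =>
    ⟨(norm_eq_one_iff_closedBallHomeomorphCube_mem_boundary z.1).1 hz.1, mem_univ _⟩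
  have hXB : FinRelHomology R R (↥(closedBall (0 : Fin n → ℝ) 1) × F) SF (N + n) :=
    FinRelHomology.of_homeomorph eB heB heB' hcube
  have hχXB : relEuler R R (↥(closedBall (0 : Fin n → ℝ) 1) × F) SF = (-1) ^ n * relEuler R R F ∅ := by
    rw [← relEuler_eq_of_homeomorph eB heB heB', hχcube]
  -- `(collar × F, sphere × F)` is acyclic
  have hcol : IsStrongDeformationRetractOf SF CF :=
    isStrongDeformationRetractOf_collar_prod (by norm_num) (by norm_num)
  have hABzero : ∀ k, IsZero (relativeSingularHomology R R ↥CF (Subtype.val ⁻¹' SF) k) :=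
    fun k => hcol.isZero_relativeSingularHomology R R hSC k
  have hAB : FinRelHomology R R ↥CF (Subtype.val ⁻¹' SF) (N + n) :=
    (FinRelHomology.of_isZero hABzero).mono (Nat.zero_le _)
  obtain ⟨hXA, hχXA⟩ := FinRelHomology.triple_right hSC hAB hXB
  rw [relEuler_eq_zero_of_isZero hABzero, zero_add, hχXB] at hχXA
  -- `hXA : FinRelHomology (𝔹 × F) CF (N + n + 1)`, `hχXA : χ(𝔹 × F, SF) … = χ(𝔹 × F, CF)` reads
  /- Step 5: back to `E` -/
  have hΨm : MapsTo Ψ (Subtype.val ⁻¹' (p ⁻¹' A') : Set ↥K) CF := fun e he => (hΨ e).1 he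
  have hΨm' : MapsTo Ψ.symm CF (Subtype.val ⁻¹' (p ⁻¹' A') : Set ↥K) := fun z hz => by
    have := (hΨ (Ψ.symm z)).2
    rw [Homeomorph.apply_symm_apply] at this
    exact this hz
  have hK1 : FinRelHomology R R ↥K (Subtype.val ⁻¹' (p ⁻¹' A')) (N + n + 1) :=
    FinRelHomology.of_homeomorph Ψ.symm hΨm' hΨm hXA
  have hχK : relEuler R R ↥K (Subtype.val ⁻¹' (p ⁻¹' A')) = (-1) ^ n * relEuler R R F ∅ := by
    rw [relEuler_eq_of_homeomorph Ψ hΨm hΨm', ← hχXA]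
  -- `↥Kᶜᶜ ≃ₜ ↥K`
  let eK : ↥Kᶜᶜ ≃ₜ ↥K := Homeomorph.setCongr (compl_compl K)
  have heK : MapsTo eK (Subtype.val ⁻¹' (p ⁻¹' A') : Set ↥Kᶜᶜ) (Subtype.val ⁻¹' (p ⁻¹' A') : Set ↥K) :=
    fun z hz => hz
  have heK' : MapsTo eK.symm (Subtype.val ⁻¹' (p ⁻¹' A') : Set ↥K) (Subtype.val ⁻¹' (p ⁻¹' A') : Set ↥Kᶜᶜ) :=
    fun z hz => hz
  have hK2 : FinRelHomology R R ↥Kᶜᶜ (Subtype.val ⁻¹' (p ⁻¹' A')) (N + n + 1) :=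
    FinRelHomology.of_homeomorph eK.symm heK' heK hK1
  have hχK2 : relEuler R R ↥Kᶜᶜ (Subtype.val ⁻¹' (p ⁻¹' A')) = (-1) ^ n * relEuler R R F ∅ := by
    rw [relEuler_eq_of_homeomorph eK heK heK', hχK]
  -- excision isomorphisms
  have hXA' : FinRelHomology R R E (p ⁻¹' A') (N + n + 1) :=
    hK2.of_iso fun k => by haveI := hexc k; exact asIso (relativeSingularHomology.map R R
      (X := ↥Kᶜᶜ) (subsetIncl Kᶜᶜ) (mapsTo_preimage Subtype.val (p ⁻¹' A')) k)
  have hχA' : relEuler R R E (p ⁻¹' A') = (-1) ^ n * relEuler R R F ∅ := by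
    rw [← hχK2]
    refine (relEuler_eq_of_iso fun k => ?_).symm
    haveI := hexc k
    exact asIso (relativeSingularHomology.map R R (X := ↥Kᶜᶜ) (subsetIncl Kᶜᶜ)
      (mapsTo_preimage Subtype.val (p ⁻¹' A')) k)
  /- Step 6: the triple `p⁻¹Y ⊆ p⁻¹A' ⊆ E` -/
  have hAB' : FinRelHomology R R ↥(p ⁻¹' A') (Subtype.val ⁻¹' (p ⁻¹' Y)) (N + n + 1) :=
    (FinRelHomology.of_isZero hzero).mono (Nat.zero_le _)
  obtain ⟨hfin, hχ⟩ := FinRelHomology.triple_mid (preimage_mono hYA' : p ⁻¹' Y ⊆ p ⁻¹' A') hAB' hXA'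
  refine ⟨hfin, ?_⟩
  rw [hχ, relEuler_eq_zero_of_isZero hzero, zero_add, hχA']

/-- The radial projection of `ℝⁿ` onto the closed unit ball (sup norm), `x ↦ x / max 1 ‖x‖`.
[folklore] -/
theorem continuous_ballProj {n : ℕ} :
    Continuous fun x : Fin n → ℝ => (max 1 ‖x‖)⁻¹ • x :=
  ((continuous_const.max continuous_norm).inv₀ fun x =>
    (lt_of_lt_of_le one_pos (le_max_left 1 ‖x‖)).ne').smul continuous_id

/-- The radial projection lands in the closed unit ball. [folklore] -/
theorem ballProj_mem {n : ℕ} (x : Fin n → ℝ) :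
    (max 1 ‖x‖)⁻¹ • x ∈ closedBall (0 : Fin n → ℝ) 1 := by
  have hm : 0 < max 1 ‖x‖ := lt_of_lt_of_le one_pos (le_max_left 1 ‖x‖)
  rw [mem_closedBall_zero_iff, norm_smul, Real.norm_eq_abs, abs_of_pos (inv_pos.2 hm),
    inv_mul_le_iff₀ hm, mul_one]
  exact le_max_right _ _

/-- The radial projection is the identity on the closed unit ball. [folklore] -/
theorem ballProj_of_mem {n : ℕ} {x : Fin n → ℝ} (hx : x ∈ closedBall (0 : Fin n → ℝ) 1) :
    (max 1 ‖x‖)⁻¹ • x = x := by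
  rw [max_eq_left (mem_closedBall_zero_iff.1 hx), inv_one, one_smul]

/-- **`χ(p⁻¹(Y ∪ ē), p⁻¹Y) = (-1)ⁿ χ(F)`, the cell attached inside an arbitrary base**: as
`finRelHomology_preimage_of_cell`, without the hypothesis `X = Y ∪ Φ(𝔹ⁿ)`, the pair being
realised on the subspace `p⁻¹(Y ∪ Φ(𝔹ⁿ))` of `E` (the previous theorem for the bundle restricted
over `Y ∪ Φ(𝔹ⁿ)`, with `Φ` precomposed with the radial projection onto the ball so as to be defined
on all of `ℝⁿ`). This is the form consumed by the induction over the cells of a CW complex.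
[cite: Spanier1981, Ch. 9, Sec. 2, Lemma 2 and Thm. 15 (a)] -/
theorem finRelHomology_preimage_union_cell {E : Type u} {X : Type v} {F : Type w}
    [TopologicalSpace E] [TopologicalSpace X] [T2Space X] [TopologicalSpace F] {p : E → X}
    (hp : IsFibreBundleWith F p) {n : ℕ} {Y : Set X} (hY : IsClosed Y) (Φ : (Fin n → ℝ) → X)
    (hΦ : ContinuousOn Φ (closedBall 0 1)) (hinj : InjOn Φ (ball 0 1))
    (hsph : ∀ x : Fin n → ℝ, ‖x‖ = 1 → Φ x ∈ Y) (hdisj : ∀ x : Fin n → ℝ, ‖x‖ < 1 → Φ x ∉ Y)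
    (R : Type uR) [Field R] {N : ℕ} (hF : FinRelHomology R R F ∅ N) :
    FinRelHomology R R ↥(p ⁻¹' (Y ∪ Φ '' closedBall 0 1)) (Subtype.val ⁻¹' (p ⁻¹' Y))
        (N + n + 1) ∧
      relEuler R R ↥(p ⁻¹' (Y ∪ Φ '' closedBall 0 1)) (Subtype.val ⁻¹' (p ⁻¹' Y)) =
        (-1) ^ n * relEuler R R F ∅ := by
  set X₁ : Set X := Y ∪ Φ '' closedBall 0 1 with hX₁
  have hX₁Φ : ∀ x ∈ closedBall (0 : Fin n → ℝ) 1, Φ x ∈ X₁ := fun x hx => Or.inr ⟨x, hx, rfl⟩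
  -- `Φ` precomposed with the radial projection, as a map into `↥X₁`
  let Φ₁ : (Fin n → ℝ) → ↥X₁ := fun x => ⟨Φ ((max 1 ‖x‖)⁻¹ • x), hX₁Φ _ (ballProj_mem x)⟩
  have hΦ₁c : Continuous Φ₁ :=
    (hΦ.comp_continuous continuous_ballProj ballProj_mem).subtype_mk _
  have hΦ₁ : ∀ x ∈ closedBall (0 : Fin n → ℝ) 1, (Φ₁ x : X) = Φ x := fun x hx => by
    show Φ ((max 1 ‖x‖)⁻¹ • x) = Φ x
    rw [ballProj_of_mem hx]
  have hp₁ : IsFibreBundleWith F (X₁.restrictPreimage p) := hp.restrictPreimage X₁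
  have hY₁ : IsClosed (Subtype.val ⁻¹' Y : Set ↥X₁) := hY.preimage continuous_subtype_val
  have hinj₁ : InjOn Φ₁ (ball 0 1) := fun x hx y hy h => by
    have h' : Φ x = Φ y := by
      rw [← hΦ₁ x (ball_subset_closedBall hx), ← hΦ₁ y (ball_subset_closedBall hy), h]
    exact hinj hx hy h'
  have hsph₁ : ∀ x : Fin n → ℝ, ‖x‖ = 1 → Φ₁ x ∈ (Subtype.val ⁻¹' Y : Set ↥X₁) := fun x hx => by
    show (Φ₁ x : X) ∈ Y
    rw [hΦ₁ x (mem_closedBall_zero_iff.2 hx.le)]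
    exact hsph x hx
  have hdisj₁ : ∀ x : Fin n → ℝ, ‖x‖ < 1 → Φ₁ x ∉ (Subtype.val ⁻¹' Y : Set ↥X₁) := fun x hx h => by
    have h' : (Φ₁ x : X) ∈ Y := h
    rw [hΦ₁ x (mem_closedBall_zero_iff.2 hx.le)] at h'
    exact hdisj x hx h'
  have hcov₁ : (Subtype.val ⁻¹' Y : Set ↥X₁) ∪ Φ₁ '' closedBall 0 1 = univ := by
    refine eq_univ_of_forall fun z => ?_
    rcases z.2 with hz | ⟨x, hx, hxz⟩
    · exact Or.inl hz
    · refine Or.inr ⟨x, hx, Subtype.ext ?_⟩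
      rw [hΦ₁ x hx]; exact hxz
  exact finRelHomology_preimage_of_cell hp₁ hY₁ Φ₁ hΦ₁c.continuousOn hinj₁ hsph₁ hdisj₁ hcov₁ R hF

end IsFibreBundleWith

end Literature.AlgebraicTopology.Homotopy
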